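import Summits.QuantumFields.YangMills.Theses.PencilRigidity
import Literature.MathematicalPhysics.QuantumFieldTheory.LatticeGaugeStrongCouplingProofs
import Literature.MathematicalPhysics.QuantumFieldTheory.YangMillsEuclideanProofs
import Literature.MathematicalPhysics.QuantumFieldTheory.TorusFreeTransfer
import Literature.MathematicalPhysics.AQFT.OSAxiomsSchwinger
import Literature.MathematicalPhysics.QuantumFieldTheory.OSData

/-!
# `DiagonalMirrorRPR` — negative lemmas: the infinite-coupling slice cannot refute the crux

Supports crux item `stmt-QuantumFields-10604` (`PencilRigidity.DiagonalMirrorRPR` =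
`MirrorModularBoosts.DiagonalMirrorRPR`: for every compact simple `G`, `r`, `sch`, `S₁` carrying the
curvature package `W₁`, `S₁` pulled back by every diagonal frame `R e₀ = (±e₀ ± e₁)/√2` is reflection
positive). Three checked facts that close the cheap counterexample hunt on the `β ≡ 0` / `c ≡ 0` slice of the
hypothesis space:

* `hasLatticeMassGap_of_beta_eq_zero`: for EVERY `G`, `r`, every scheme with `β_k = 0` and every real `Δ`,
  `HasLatticeMassGap r sch Δ` holds (Haar product measure: bond-disjoint gauge-invariant observables are
  independent, so connected time-correlations vanish beyond the support diameters) — the uniform-gap clause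
  of `W₁` has no force at infinite coupling;
* `diagonalPullback_vacuumFamily_isReflectionPositive`: the vacuum family (the `c ≡ 0` limits) is RP in
  every frame;
* `constField_pullback_isReflectionPositive`: the constant fields `𝔖ₙ(F) = κⁿ ∫ F` (the `β ≡ 0` limits on
  `⁰𝒮` for arbitrary renormalisations `c_k, m_k`) are RP in EVERY frame `R` (all linear isometries):
  `∑ᵢⱼ κ^{dᵢ+dⱼ} ∫ R·(θFᵢ* ⊗ Fⱼ) = |∑ⱼ κ^{dⱼ} ∫ Fⱼ|² ≥ 0` (`integral_linActMulti`, `integral_appendTensor`,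
  `integral_osAdjoint`).

So a counterexample to the crux needs a genuine, non-ultralocal gapped Wilson continuum limit.
-/

noncomputable section

open scoped SchwartzMap ComplexConjugate
open MeasureTheory Filter Topology Complex
open Literature.MathematicalPhysics.QuantumLattice Literature.MathematicalPhysics.AQFT
  Literature.MathematicalPhysics.QuantumFieldTheory

namespace Summit.QuantumFields.YangMills.Theorems.DiagonalMirrorRPR.Negative

/-- Euclidean `ℝ⁴`, time = coordinate `0`. [folklore] -/
abbrev E4 : Type := EuclideanSpace ℝ (Fin 4)

section NonVacuity

variable {G : Type} [Group G] [TopologicalSpace G] [IsTopologicalGroup G] [CompactSpace G]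
  [MeasurableSpace G] [BorelSpace G]

/-- Eventually `M ≤ L_k` along any scheme (`a_k → 0` and `a_k L_k → ∞` force `L_k → ∞`). [folklore] -/
theorem eventually_le_schemeL {ι : Type} (sch : SpeciesScheme ι) (M : ℕ) :
    ∀ᶠ k in atTop, M ≤ sch.L k := by
  have ha : ∀ᶠ k in atTop, sch.a k ≤ 1 :=
    (sch.tendsto_a.eventually (gt_mem_nhds (by norm_num : (0 : ℝ) < 1))).mono fun k hk => hk.le
  have hL : ∀ᶠ k in atTop, (M : ℝ) ≤ sch.a k * sch.L k := sch.tendsto_L.eventually (eventually_ge_atTop _)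
  filter_upwards [ha, hL] with k hak hLk
  have hpos := sch.a_pos k
  have h1 : sch.a k * sch.L k ≤ sch.L k := by
    have := mul_le_of_le_one_left (Nat.cast_nonneg (sch.L k)) hak
    simpa using this
  exact_mod_cast hLk.trans h1

/-- **Uniform lattice gap at `β ≡ 0`, every rate.** If the scheme's couplings vanish, the torus Wilson
measure is the Haar product; two gauge-invariant local observables at time separation beyond the sum of
their support diameters are independent (transfer to `ℤ⁴`, `integral_mul_of_dependsOn`), so the connected
correlation VANISHES there, and the finitely many short separations are absorbed in the constant. Hence
`HasLatticeMassGap r sch Δ` for every real `Δ` — the clause has no force at infinite coupling. [folklore] -/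
theorem hasLatticeMassGap_of_beta_eq_zero (r : LatticeRep G) (sch : SpeciesScheme (YMSpecies G))
    (hβ : ∀ k, sch.β k = 0) (Δ : ℝ) : HasLatticeMassGap r sch Δ := by
  intro A B
  classical
  obtain ⟨MA, hMA⟩ := A.bounded
  obtain ⟨MB, hMB⟩ := B.bounded
  have hMA0 : 0 ≤ MA := (abs_nonneg _).trans (hMA fun _ => 1)
  have hMB0 : 0 ≤ MB := (abs_nonneg _).trans (hMB fun _ => 1)
  -- the finitely many time separations with overlapping supports, and a radius for the supports
  let D : Finset ℤ := (A.supp ×ˢ B.supp).image fun p => (p.1.1 - p.2.1) 0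
  let N₀ : ℕ := D.sum (fun z => z.natAbs) + 1
  let Rad : ℕ := (A.supp ∪ B.supp).sum fun e => ∑ i, (e.1 i).natAbs
  have hRad : ∀ e ∈ A.supp ∪ B.supp, ∀ i, |e.1 i| ≤ Rad := by
    intro e he i
    have h1 : (e.1 i).natAbs ≤ ∑ j, (e.1 j).natAbs :=
      Finset.single_le_sum (f := fun j => (e.1 j).natAbs) (fun _ _ => Nat.zero_le _) (Finset.mem_univ i)
    have h2 : ∑ j, (e.1 j).natAbs ≤ Rad :=
      Finset.single_le_sum (f := fun e => ∑ j, (e.1 j).natAbs) (fun _ _ => Nat.zero_le _) he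
    rw [Int.abs_eq_natAbs]
    exact_mod_cast h1.trans h2
  have ha1 : ∀ᶠ k in atTop, sch.a k ≤ 1 :=
    (sch.tendsto_a.eventually (gt_mem_nhds (by norm_num : (0 : ℝ) < 1))).mono fun k hk => hk.le
  refine ⟨2 * MA * MB * Real.exp (|Δ| * N₀) + 1, ?_⟩
  filter_upwards [eventually_le_schemeL sch (2 * Rad), ha1] with k hk hak S hS n hn
  have hRS : 2 * Rad ≤ S := hk.trans hS
  rw [hβ k]
  show |latticeConnectedCorr r.ρ 0 (2 * S + 1) A.F B.F n| ≤
    (2 * MA * MB * Real.exp (|Δ| * N₀) + 1) * Real.exp (-(Δ * (sch.a k * n)))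
  have hC0 : 0 ≤ 2 * MA * MB * Real.exp (|Δ| * N₀) + 1 := by positivity
  by_cases hnN : n < N₀
  · -- overlapping supports: the crude bound `2 M_A M_B`
    have e1 := abs_wilsonExpectation_le_of_abs_le (L := 2 * S + 1) r.ρ r.continuous 0
      (F := fun U => A.F (torusLift (2 * S + 1) U) *
        B.F (configShift (-Pi.single 0 (n : ℤ)) (torusLift (2 * S + 1) U)))
      (C := MA * MB) fun U => by
        rw [abs_mul]; exact mul_le_mul (hMA _) (hMB _) (abs_nonneg _) hMA0
    have e2 := abs_wilsonExpectation_le_of_abs_le (L := 2 * S + 1) r.ρ r.continuous 0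
      (F := fun U => A.F (torusLift (2 * S + 1) U)) (C := MA) fun U => hMA _
    have e3 := abs_wilsonExpectation_le_of_abs_le (L := 2 * S + 1) r.ρ r.continuous 0
      (F := fun U => B.F (torusLift (2 * S + 1) U)) (C := MB) fun U => hMB _
    simp only [wilsonExpectation] at e1 e2 e3
    have hcorr : |latticeConnectedCorr r.ρ 0 (2 * S + 1) A.F B.F n| ≤ 2 * MA * MB := by
      unfold latticeConnectedCorr
      calc _ ≤ _ := abs_sub _ _
        _ ≤ MA * MB + MA * MB :=
          add_le_add e1 (by rw [abs_mul]; exact mul_le_mul e2 e3 (abs_nonneg _) hMA0)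
        _ = 2 * MA * MB := by ring
    have hexp : Real.exp (-(|Δ| * N₀)) ≤ Real.exp (-(Δ * (sch.a k * n))) := by
      apply Real.exp_le_exp.2
      have hn0 : (0 : ℝ) ≤ n := Nat.cast_nonneg n
      have hnN' : (n : ℝ) ≤ N₀ := by exact_mod_cast hnN.le
      have hak0 : 0 ≤ sch.a k := (sch.a_pos k).le
      have h1 : Δ * (sch.a k * n) ≤ |Δ| * (sch.a k * n) :=
        mul_le_mul_of_nonneg_right (le_abs_self Δ) (mul_nonneg hak0 hn0)
      have h2 : |Δ| * (sch.a k * n) ≤ |Δ| * N₀ := by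
        refine mul_le_mul_of_nonneg_left ?_ (abs_nonneg Δ)
        calc sch.a k * n ≤ 1 * n := mul_le_mul_of_nonneg_right hak hn0
          _ = n := one_mul _
          _ ≤ N₀ := hnN'
      linarith
    calc |latticeConnectedCorr r.ρ 0 (2 * S + 1) A.F B.F n| ≤ 2 * MA * MB := hcorr
      _ = (2 * MA * MB * Real.exp (|Δ| * N₀)) * Real.exp (-(|Δ| * N₀)) := by
          rw [mul_assoc (2 * MA * MB), ← Real.exp_add, add_neg_cancel, Real.exp_zero, mul_one]
      _ ≤ (2 * MA * MB * Real.exp (|Δ| * N₀) + 1) * Real.exp (-(|Δ| * N₀)) := by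
          gcongr; linarith
      _ ≤ (2 * MA * MB * Real.exp (|Δ| * N₀) + 1) * Real.exp (-(Δ * (sch.a k * n))) :=
          mul_le_mul_of_nonneg_left hexp hC0
  · -- disjoint supports: at `β = 0` the connected correlation vanishes
    have hnN' : N₀ ≤ n := not_lt.1 hnN
    suffices hzero : latticeConnectedCorr r.ρ 0 (2 * S + 1) A.F B.F n = 0 by
      rw [hzero, abs_zero]; positivity
    unfold latticeConnectedCorr
    set v : Literature.Probability.LatticeModels.Site 4 := -Pi.single 0 (n : ℤ) with hv
    let T := B.supp.image fun e => (e.1 - v, e.2)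
    have hB' : IsCylinder (fun U => B.F (configShift v U)) T := IsCylinder.comp_configShift B.isCylinder v
    have hAB : IsCylinder (fun U => A.F U * B.F (configShift v U)) (A.supp ∪ T) :=
      IsCylinder.mul A.isCylinder hB'
    have hslab : ∀ e ∈ A.supp ∪ T, ∀ i, -(Rad : ℤ) ≤ e.1 i ∧ e.1 i ≤ Rad + n := by
      intro e he i
      rcases Finset.mem_union.1 he with heA | heT
      · have h := abs_le.1 (hRad e (Finset.mem_union_left _ heA) i)
        exact ⟨h.1, h.2.trans (by omega)⟩
      · obtain ⟨b', hb', rfl⟩ := Finset.mem_image.1 heT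
        have h := abs_le.1 (hRad b' (Finset.mem_union_right _ hb') i)
        have hsingle : (0 : ℤ) ≤ Pi.single (M := fun _ : Fin 4 => ℤ) 0 (n : ℤ) i ∧
            Pi.single (M := fun _ : Fin 4 => ℤ) 0 (n : ℤ) i ≤ n := by
          by_cases hi : i = 0
          · subst hi; simp
          · simp [hi]
        simp only [hv, Pi.sub_apply, Pi.neg_apply, sub_neg_eq_add]
        exact ⟨by omega, by omega⟩
    have hinj : Set.InjOn (torusEdge (d := 4) (2 * S + 1)) ↑(A.supp ∪ T) := by
      intro e he e' he' hee'
      simp only [torusEdge, Prod.mk.injEq] at hee'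
      refine Prod.ext (funext fun i => ?_) hee'.2
      have hk : ((e.1 i : ℤ) : ZMod (2 * S + 1)) = ((e'.1 i : ℤ) : ZMod (2 * S + 1)) := by
        have := congrFun hee'.1 i
        simpa [Literature.Probability.LatticeModels.Torus.proj_apply] using this
      have hdvd := (ZMod.intCast_eq_intCast_iff_dvd_sub _ _ _).1 hk
      obtain ⟨lo, hi⟩ := hslab e he i
      obtain ⟨lo', hi'⟩ := hslab e' he' i
      have hlt : |e'.1 i - e.1 i| < ((2 * S + 1 : ℕ) : ℤ) := by
        rw [abs_lt]; push_cast; constructor <;> omega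
      have h0 := Int.eq_zero_of_abs_lt_dvd hdvd hlt
      omega
    have hdisj : Disjoint A.supp T := by
      rw [Finset.disjoint_left]
      intro e heA heT
      obtain ⟨b', hb', hbe⟩ := Finset.mem_image.1 heT
      have hmem : (n : ℤ) ∈ D := by
        refine Finset.mem_image.2 ⟨(e, b'), Finset.mem_product.2 ⟨heA, hb'⟩, ?_⟩
        rw [← hbe]
        simp [hv]
      have hle : (n : ℤ).natAbs ≤ D.sum fun z => z.natAbs :=
        Finset.single_le_sum (f := fun z : ℤ => z.natAbs) (fun _ _ => Nat.zero_le _) hmem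
      simp only [Int.natAbs_natCast] at hle
      omega
    have hW0 : wilsonMeasure (d := 4) (L := 2 * S + 1) r.ρ 0 = Measure.pi fun _ => haarProbability G := by
      have h1 : wilsonWeight (d := 4) (L := 2 * S + 1) r.ρ 0 = Measure.pi fun _ => haarProbability G := by
        unfold wilsonWeight
        simp only [neg_zero, zero_mul, Real.exp_zero, ENNReal.ofReal_one]
        exact withDensity_one
      unfold wilsonMeasure partitionFunction
      rw [h1, measure_univ, inv_one, one_smul]
    have tA := integral_torusLift_eq_integral_zdHaar (L := 2 * S + 1) (F := A.F)
      (hinj.mono (Finset.coe_subset.2 Finset.subset_union_left)) A.measurable A.isCylinder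
    have tB := integral_torusLift_eq_integral_zdHaar (L := 2 * S + 1)
      (F := fun U => B.F (configShift v U))
      (hinj.mono (Finset.coe_subset.2 Finset.subset_union_right))
      (B.measurable.comp (configShift v).measurable) hB'
    have tAB := integral_torusLift_eq_integral_zdHaar (L := 2 * S + 1)
      (F := fun U => A.F U * B.F (configShift v U)) hinj
      (A.measurable.mul (B.measurable.comp (configShift v).measurable)) hAB
    have hind := integral_mul_of_dependsOn (G := G)
      (g := fun U => (A.F U : ℂ)) (h := fun U => (B.F (configShift v U) : ℂ)) hdisj
      (Complex.measurable_ofReal.comp A.measurable)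
      (Complex.measurable_ofReal.comp (B.measurable.comp (configShift v).measurable))
      (fun U V hUV => by simp only [A.isCylinder hUV]) (fun U V hUV => by simp only [hB' hUV])
    have hreal : ∫ U, A.F U * B.F (configShift v U) ∂(zdHaar 4 G) =
        (∫ U, A.F U ∂(zdHaar 4 G)) * ∫ U, B.F (configShift v U) ∂(zdHaar 4 G) := by
      apply Complex.ofReal_injective
      rw [Complex.ofReal_mul, ← integral_complex_ofReal, ← integral_complex_ofReal,
        ← integral_complex_ofReal]
      simp only [Complex.ofReal_mul]
      exact hind
    have hZ : ∫ U, B.F (torusLift (2 * S + 1) U) ∂(wilsonMeasure (d := 4) (L := 2 * S + 1) r.ρ 0) =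
        ∫ U, B.F (configShift v (torusLift (2 * S + 1) U))
          ∂(wilsonMeasure (d := 4) (L := 2 * S + 1) r.ρ 0) := by
      have ht := wilsonExpectation_comp_torusConfigShift (ρ := r.ρ) (L := 2 * S + 1) 0
        (Literature.Probability.LatticeModels.Torus.proj (2 * S + 1) v) (toTorusObservable (2 * S + 1) B.F)
      rw [← toTorusObservable_comp_configShift] at ht
      simp only [wilsonExpectation, toTorusObservable_apply, Function.comp_apply] at ht
      exact ht.symm
    rw [hZ, hW0, tAB, tA, tB, hreal, sub_self]

/-- The vacuum-only one-species family `𝔖₀ = 1`, `𝔖ₙ = 0` (`n ≥ 1`). [folklore] -/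
def vacuumFamily : SchwingerFamily E4 := fun n => LabelledSchwingerFamily.trivial Unit E4 n fun _ => ()

/-- Its labelled version is the tree's vacuum-only labelled family. [folklore] -/
theorem vacuumFamily_toLabelled : vacuumFamily.toLabelled = LabelledSchwingerFamily.trivial Unit E4 := by
  funext n k
  rw [SchwingerFamily.toLabelled_apply, Subsingleton.elim k fun _ => ()]
  rfl

/-- Pulling the vacuum family back along any linear isometry gives the vacuum family again. [folklore] -/
theorem vacuumFamily_pullback (R : E4 ≃ₗᵢ[ℝ] E4) :
    (SchwingerFamily.toLabelled fun n => (vacuumFamily n).comp (linActMulti R)) =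
      LabelledSchwingerFamily.trivial Unit E4 := by
  funext n k
  rw [SchwingerFamily.toLabelled_apply]
  ext F
  rw [ContinuousLinearMap.comp_apply]
  show LabelledSchwingerFamily.trivial Unit E4 n (fun _ => ()) (linActMulti R F) =
    LabelledSchwingerFamily.trivial Unit E4 n k F
  rcases Nat.eq_zero_or_pos n with rfl | hn
  · rw [LabelledSchwingerFamily.trivial_zero_apply _ _ _ 0, LabelledSchwingerFamily.trivial_zero_apply _ _ _ 0,
      linActMulti_apply]
    congr 1
    exact Subsingleton.elim _ _
  · simp [LabelledSchwingerFamily.trivial_of_ne_zero _ hn.ne']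

/-- **The vacuum family is reflection positive in every frame.** [folklore] -/
theorem diagonalPullback_vacuumFamily_isReflectionPositive (R : E4 ≃ₗᵢ[ℝ] E4) :
    (SchwingerFamily.toLabelled fun n => (vacuumFamily n).comp (linActMulti R)).IsReflectionPositive := by
  rw [vacuumFamily_pullback]
  exact (OSAxiomsSchwinger.trivial (ι := Unit) (d := 4)).reflectionPositive

end NonVacuity

section ConstField

variable {n m : ℕ}

/-- Lebesgue measure on `(ℝ⁴)ⁿ` has temperate growth (instance search does not find the add-Haar route
through the `PiLp` coordinates unaided). [folklore] -/
instance volume_pi_E4_hasTemperateGrowth (n : ℕ) : (volume : Measure (Fin n → E4)).HasTemperateGrowth :=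
  Measure.IsAddHaarMeasure.instHasTemperateGrowth

/-- Lebesgue integration of an `n`-point test function, `F ↦ ∫ F`, as a continuous functional. [folklore] -/
def integ (n : ℕ) : 𝓢((Fin n → E4), ℂ) →L[ℂ] ℂ :=
  SchwartzMap.integralCLM ℂ (volume : Measure (Fin n → E4))

/-- `integ n F = ∫ F`. [folklore] -/
theorem integ_apply (F : 𝓢((Fin n → E4), ℂ)) : integ n F = ∫ x, F x := by
  simp [integ]

/-- **The constant field `φ ≡ κ`**: `𝔖ₙ(F) = κⁿ ∫ F` (the law of the deterministic configuration `κ`;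
the `β ≡ 0` continuum limits of the crux's lattice data on `⁰𝒮`, see the section doc). [folklore] -/
def constField (κ : ℝ) : SchwingerFamily E4 := fun n => ((κ : ℂ) ^ n) • integ n

/-- `constField κ n F = κⁿ ∫ F`. [folklore] -/
theorem constField_apply (κ : ℝ) (F : 𝓢((Fin n → E4), ℂ)) :
    constField κ n F = (κ : ℂ) ^ n * ∫ x, F x := by
  simp [constField, integ_apply]

/-- The diagonal action of a linear isometry preserves Lebesgue measure on `(ℝ⁴)ⁿ`. [folklore] -/
theorem integral_linActMulti (R : E4 ≃ₗᵢ[ℝ] E4) (F : 𝓢((Fin n → E4), ℂ)) :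
    ∫ x, linActMulti R F x = ∫ x, F x := by
  let e : (Fin n → E4) ≃ᵐ (Fin n → E4) :=
    MeasurableEquiv.piCongrRight fun _ => R.symm.toHomeomorph.toMeasurableEquiv
  have he : MeasurePreserving e volume volume :=
    volume_preserving_pi fun _ => R.symm.measurePreserving
  exact he.integral_comp' (fun x => F x)

/-- Splitting `(ℝ⁴)^{n+m} = (ℝ⁴)ⁿ × (ℝ⁴)ᵐ` along `Fin.append`, as a measurable equivalence. [folklore] -/
def appendSplit (n m : ℕ) : (Fin (n + m) → E4) ≃ᵐ (Fin n → E4) × (Fin m → E4) :=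
  (MeasurableEquiv.piCongrLeft (fun _ : Fin (n + m) => E4) finSumFinEquiv).symm.trans
    (MeasurableEquiv.sumPiEquivProdPi fun _ : Fin n ⊕ Fin m => E4)

/-- `appendSplit` splits along `Fin.castAdd` / `Fin.natAdd`. [folklore] -/
theorem appendSplit_apply (x : Fin (n + m) → E4) :
    appendSplit n m x = (x ∘ Fin.castAdd m, x ∘ Fin.natAdd n) := rfl

/-- `appendSplit` preserves Lebesgue measure. [folklore] -/
theorem measurePreserving_appendSplit (n m : ℕ) :
    MeasurePreserving (appendSplit n m) volume volume :=
  ((volume_measurePreserving_piCongrLeft (fun _ : Fin (n + m) => E4) finSumFinEquiv).symm _).trans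
    (volume_measurePreserving_sumPiEquivProdPi fun _ : Fin n ⊕ Fin m => E4)

/-- `∫ (A ⊗ B) = (∫ A)(∫ B)` for appended tensor products. [folklore] -/
theorem integral_appendTensor {H : 𝓢((Fin (n + m) → E4), ℂ)} {A : 𝓢((Fin n → E4), ℂ)}
    {B : 𝓢((Fin m → E4), ℂ)} (hH : IsAppendTensorOf H A B) :
    ∫ x, H x = (∫ y, A y) * ∫ z, B z := by
  have h1 : (fun x => H x) = fun x => (fun p : (Fin n → E4) × (Fin m → E4) => A p.1 * B p.2) (appendSplit n m x) := by
    funext x; rw [hH x, appendSplit_apply]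
  rw [h1]
  exact ((measurePreserving_appendSplit n m).integral_comp'
    (fun p : (Fin n → E4) × (Fin m → E4) => A p.1 * B p.2)).trans (integral_prod_mul _ _)

/-- `∫ θF* = conj ∫ F`. [folklore] -/
theorem integral_osAdjoint (F : 𝓢((Fin n → E4), ℂ)) :
    ∫ x, osAdjoint F x = conj (∫ x, F x) := by
  let e₁ : (Fin n → E4) ≃ᵐ (Fin n → E4) := (MeasurableEquiv.piCongrLeft (fun _ : Fin n => E4) Fin.revPerm).symm
  let e₂ : (Fin n → E4) ≃ᵐ (Fin n → E4) :=
    MeasurableEquiv.piCongrRight fun _ => (timeReflection 4).toHomeomorph.toMeasurableEquiv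
  have h₁ : MeasurePreserving e₁ volume volume :=
    (volume_measurePreserving_piCongrLeft (fun _ : Fin n => E4) Fin.revPerm).symm _
  have h₂ : MeasurePreserving e₂ volume volume :=
    volume_preserving_pi fun _ => (timeReflection 4).measurePreserving
  have h12 : MeasurePreserving (e₁.trans e₂) volume volume := h₂.comp h₁
  have he : (fun x => osAdjoint F x) = fun x => conj (F ((e₁.trans e₂) x)) := by
    funext x
    rw [osAdjoint_apply]
    rfl
  rw [he, integral_conj, h12.integral_comp' (fun y => F y)]

/-- **Constant fields are reflection positive in every frame** (all linear isometries `R`, not only the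
diagonal ones): `∑ᵢⱼ κ^{dᵢ+dⱼ} ∫ R·(θFᵢ* ⊗ Fⱼ) = |∑ⱼ κ^{dⱼ} ∫ Fⱼ|² ≥ 0`. In particular `DiagonalFrameRP
(constField κ)`: the `β ≡ 0` slice of the hypothesis space (whatever the renormalisations `c_k, m_k`) cannot
refute the crux. [folklore] -/
theorem constField_pullback_isReflectionPositive (κ : ℝ) (R : E4 ≃ₗᵢ[ℝ] E4) :
    (SchwingerFamily.toLabelled (fun n => (constField κ n).comp (linActMulti R))).IsReflectionPositive := by
  intro N deg lab F hF H hH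
  let c : Fin N → ℂ := fun j => (κ : ℂ) ^ deg j * ∫ x, F j x
  have hterm : ∀ i j, (SchwingerFamily.toLabelled (fun n => (constField κ n).comp (linActMulti R)))
      (deg i + deg j) (Fin.append (lab i ∘ Fin.rev) (lab j)) (H i j) = conj (c i) * c j := by
    intro i j
    rw [SchwingerFamily.toLabelled_apply, ContinuousLinearMap.comp_apply, constField_apply,
      integral_linActMulti, integral_appendTensor (hH i j), integral_osAdjoint]
    simp only [c, map_mul, map_pow, Complex.conj_ofReal, pow_add]
    ring
  have hsum : ∑ i, ∑ j, conj (c i) * c j = conj (∑ i, c i) * ∑ j, c j := by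
    rw [map_sum, Finset.sum_mul]
    refine Finset.sum_congr rfl fun i _ => ?_
    rw [Finset.mul_sum]
  simp only [hterm]
  rw [hsum, mul_comm, Complex.mul_conj, Complex.ofReal_re, Complex.ofReal_im]
  exact ⟨Complex.normSq_nonneg _, rfl⟩

end ConstField

end Summit.QuantumFields.YangMills.Theorems.DiagonalMirrorRPR.Negative
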